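import Literature.MathematicalPhysics.QuantumFieldTheory.YangMillsOS
import Summits.QuantumFields.YangMills.Theorems.ScalingWindowSplitCurvatureAmnesiaStubWardNullityOne
import Summits.QuantumFields.YangMills.Theorems.ScalingWindowSplitCurvatureAmnesiaLatticeTranslationCovariance
import HarnessLib

/-!
# Exact summation by parts for the lattice rotation generator (crux stmt-QuantumFields-16192, line `WardDefectSketch`)

Support file for the crux item stmt-QuantumFields-16192 (`CoincidenceRotationBootstrap.CurvatureAmnesia`,
shared verbatim with `ScalingWindowSplit.CurvatureAmnesia`), line `WardDefectSketch`, step (W-exact a) of the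
lattice rotation-Ward engine: the registered sub-goal `smearedLatticeField_latticeRotGen`.

The Ward insertion is the smeared lattice field `Φ(L f)`, `L f = x₁ ∂₀ f − x₀ ∂₁ f`, with
`Φ(g)(U) = c a⁴ Σ_{y ∈ Λ} g(a y) (O(τ_y U) − m)`, `τ_y U = configShift (-y) U` (`smearedLatticeField`).
Step (W-exact a) replaces `∂_μ f` by the LATTICE difference quotient `a⁻¹ (f(· + a e_μ) − f)`
(`translateTest (-(a • e_μ)) f = f (· + a e_μ)`), giving the test function
`D_a f = x₁ · a⁻¹ (f(· + a e₀) − f) − x₀ · a⁻¹ (f(· + a e₁) − f)`, and then sums by parts EXACTLY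
on `ℤ⁴`:

* at a lattice point `x = a y`,
  `(D_a f)(a y) = y₁ (f(a (y + e₀')) − f(a y)) − y₀ (f(a (y + e₁')) − f(a y))`
  with `e_μ' = Pi.single μ 1 ∈ ℤ⁴` (`LatticeRotGen.diffQuot_coord_apply`; uses `a ≠ 0`);
* the shifted terms are reindexed by `z = y + e_μ'`, which does not change the transverse coordinate
  (`z₁ = y₁` for `μ = 0`, `z₀ = y₀` for `μ = 1`) and is a bijection between the non-vanishing terms
  as soon as every `z` with `f(a z) ≠ 0` has `z ∈ Λ ↔ z − e_μ' ∈ Λ`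
  (`LatticeRotGen.sum_shift_reindex`, `Finset.sum_bij_ne_zero`, as in
  `LatticeTranslation.smearedLatticeField_translateTest_of_iff`);
* after reindexing the counterterms `m` cancel identically and the four sums combine to
  `−c a⁴ Σ_{y ∈ Λ} f(a y) [y₁ (O_y − O_{y − e₀'}) − y₀ (O_y − O_{y − e₁'})]`, `O_y = O(τ_y U)`
  (`LatticeRotGen.sum_sbp_combine`, pure algebra).

Everything is elementary bookkeeping (Mathlib `Finset.sum_bij_ne_zero`, `SchwartzMap.smulLeftCLM_apply_apply`);
no definitions, no notation.  References: folklore (discrete Leibniz rule / summation by parts on `ℤ⁴`).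
-/

noncomputable section

namespace Summit.QuantumFields.YangMills.Cruxes.CurvatureAmnesia.WardDefect

open scoped BigOperators Topology SchwartzMap
open Filter
open Literature.MathematicalPhysics.QuantumLattice Literature.MathematicalPhysics.AQFT
  Literature.MathematicalPhysics.QuantumFieldTheory

namespace LatticeRotGen

open LatticeTranslation (siteToE_add)

/-! ### Lattice unit vectors and the difference quotient at lattice points -/

/-- The lattice unit vector `Pi.single μ 1 ∈ ℤ^d` embeds to the Euclidean unit vector `e_μ`. [folklore] -/
theorem siteToE_single {d : ℕ} (μ : Fin d) :
    siteToE (Pi.single μ 1 : Fin d → ℤ) = EuclideanSpace.single μ (1 : ℝ) := by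
  ext j
  rw [siteToE_apply, PiLp.single_apply, Pi.single_apply]
  split_ifs <;> simp

/-- `a y + a e_μ = a (y + e_μ')` for a lattice point `y ∈ ℤ⁴` and the lattice unit vector
`e_μ' = Pi.single μ 1`. [folklore] -/
theorem smul_siteToE_add_smul_single (a : ℝ) (y : Fin 4 → ℤ) (μ : Fin 4) :
    a • siteToE y + a • (EuclideanSpace.single μ (1 : ℝ) : EuclideanSpace ℝ (Fin 4)) =
      a • siteToE (y + Pi.single μ 1) := by
  rw [siteToE_add, siteToE_single, smul_add]

/-- A coordinate of a rescaled lattice point: `(a y)_ν = a y_ν`. [folklore] -/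
theorem smul_siteToE_apply (a : ℝ) (y : Fin 4 → ℤ) (ν : Fin 4) :
    (a • siteToE y) ν = a * ((y ν : ℤ) : ℝ) := by
  rw [PiLp.smul_apply, siteToE_apply, smul_eq_mul]

/-- **The weighted lattice difference quotient at a lattice point**: for `a ≠ 0`,
`(x_ν · a⁻¹ (f(· + a e_μ) − f)) (a y) = y_ν (f(a (y + e_μ')) − f(a y))`. [folklore] -/
theorem diffQuot_coord_apply (f : 𝓢(EuclideanSpace ℝ (Fin 4), ℝ)) {a : ℝ} (ha : a ≠ 0) (μ ν : Fin 4)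
    (y : Fin 4 → ℤ) :
    SchwartzMap.smulLeftCLM ℝ (fun x : EuclideanSpace ℝ (Fin 4) => x ν)
        (a⁻¹ • (translateTest (-(a • (EuclideanSpace.single μ (1 : ℝ) : EuclideanSpace ℝ (Fin 4)))) f - f))
        (a • siteToE y) =
      ((y ν : ℤ) : ℝ) * (f (a • siteToE (y + Pi.single μ 1)) - f (a • siteToE y)) := by
  rw [SchwartzMap.smulLeftCLM_apply_apply (hasTemperateGrowth_coord ν), smul_apply, sub_apply,
    translateTest_apply, sub_neg_eq_add, smul_siteToE_add_smul_single, smul_siteToE_apply, smul_eq_mul,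
    smul_eq_mul]
  rw [show a * ((y ν : ℤ) : ℝ) * (a⁻¹ * (f (a • siteToE (y + Pi.single μ 1)) - f (a • siteToE y))) =
      a * a⁻¹ * (((y ν : ℤ) : ℝ) * (f (a • siteToE (y + Pi.single μ 1)) - f (a • siteToE y))) by ring,
    mul_inv_cancel₀ ha, one_mul]

/-! ### Reindexing the shifted sums -/

/-- **Reindexing a shifted lattice sum** `z = y + v`: if the weight `w` is `v`-periodic and every lattice
point `z` with `f(a z) ≠ 0` satisfies `z ∈ Λ ↔ z − v ∈ Λ`, then
`Σ_{y ∈ Λ} w(y) f(a (y + v)) (O_y − m) = Σ_{z ∈ Λ} w(z) f(a z) (O_{z − v} − m)`, `O_y = O(τ_y U)`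
(a bijection between the non-vanishing terms, `Finset.sum_bij_ne_zero`). [folklore] -/
theorem sum_shift_reindex {G : Type} [MeasurableSpace G] (O : LGConfig 4 G → ℝ) (Λ : Finset (Fin 4 → ℤ))
    (a m : ℝ) (f : 𝓢(EuclideanSpace ℝ (Fin 4), ℝ)) (U : LGConfig 4 G) (v : Fin 4 → ℤ)
    (w : (Fin 4 → ℤ) → ℝ) (hw : ∀ y, w (y + v) = w y)
    (h : ∀ z : Fin 4 → ℤ, f (a • siteToE z) ≠ 0 → (z ∈ Λ ↔ z - v ∈ Λ)) :
    ∑ y ∈ Λ, w y * f (a • siteToE (y + v)) * (O (configShift (-y) U) - m) =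
      ∑ z ∈ Λ, w z * f (a • siteToE z) * (O (configShift (-(z - v)) U) - m) := by
  -- adapted from `LatticeTranslation.smearedLatticeField_translateTest_of_iff`
  refine Finset.sum_bij_ne_zero (fun y _ _ => y + v) (fun y hy hne => ?_)
    (fun y₁ _ _ y₂ _ _ hy => add_right_cancel hy) (fun z hz hne => ?_) (fun y _ _ => ?_)
  · have hf : f (a • siteToE (y + v)) ≠ 0 := right_ne_zero_of_mul (left_ne_zero_of_mul hne)
    exact (h _ hf).2 (by rwa [add_sub_cancel_right])
  · have hf : f (a • siteToE z) ≠ 0 := right_ne_zero_of_mul (left_ne_zero_of_mul hne)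
    refine ⟨z - v, (h _ hf).1 hz, ?_, sub_add_cancel z v⟩
    rwa [← hw (z - v), sub_add_cancel]
  · rw [hw, add_sub_cancel_right]

/-! ### The algebra of summation by parts -/

/-- **Summation by parts, the bookkeeping**: once the two shifted sums have been reindexed
(`h₀`, `h₁`), the counterterms cancel and
`Σ [w₁ (F₀ − F) − w₀ (F₁ − F)] (P − m) = − Σ F [w₁ (P − P₀) − w₀ (P − P₁)]`. [folklore] -/
theorem sum_sbp_combine {ι : Type*} (Λ : Finset ι) (m : ℝ) (F F₀ F₁ P P₀ P₁ w₀ w₁ : ι → ℝ)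
    (h₀ : ∑ y ∈ Λ, w₁ y * F₀ y * (P y - m) = ∑ y ∈ Λ, w₁ y * F y * (P₀ y - m))
    (h₁ : ∑ y ∈ Λ, w₀ y * F₁ y * (P y - m) = ∑ y ∈ Λ, w₀ y * F y * (P₁ y - m)) :
    ∑ y ∈ Λ, (w₁ y * (F₀ y - F y) - w₀ y * (F₁ y - F y)) * (P y - m) =
      -∑ y ∈ Λ, F y * (w₁ y * (P y - P₀ y) - w₀ y * (P y - P₁ y)) := by
  have e : ∀ y ∈ Λ, (w₁ y * (F₀ y - F y) - w₀ y * (F₁ y - F y)) * (P y - m) =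
      w₁ y * F₀ y * (P y - m) - w₀ y * F₁ y * (P y - m) - F y * (w₁ y - w₀ y) * (P y - m) :=
    fun y _ => by ring
  rw [Finset.sum_congr rfl e, Finset.sum_sub_distrib, Finset.sum_sub_distrib, h₀, h₁,
    ← Finset.sum_sub_distrib, ← Finset.sum_sub_distrib, ← Finset.sum_neg_distrib]
  exact Finset.sum_congr rfl fun y _ => by ring

end LatticeRotGen

open LatticeRotGen in
/-- **Exact summation by parts for the lattice rotation generator** (crux item stmt-QuantumFields-16192, line
`WardDefectSketch`, sub-goal (W-exact a2)): for `a ≠ 0`, the smeared lattice field of the lattice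
difference-quotient rotation generator
`D_a f = x₁ · a⁻¹ (f(· + a e₀) − f) − x₀ · a⁻¹ (f(· + a e₁) − f)` is minus the lattice
angular-momentum-density insertion,
`Φ(D_a f)(U) = − c a⁴ Σ_{y ∈ Λ} f(a y) [y₁ (O_y − O_{y − e₀'}) − y₀ (O_y − O_{y − e₁'})]`,
`O_y = O(τ_y U)`, provided every lattice point `y` with `f(a y) ≠ 0` has `y ∈ Λ ↔ y − e₀' ∈ Λ` and
`y ∈ Λ ↔ y − e₁' ∈ Λ` (evaluate at lattice points, reindex the two shifted sums, cancel the
counterterms). [folklore] -/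
theorem smearedLatticeField_latticeRotGen : ∀ (G : Type) [MeasurableSpace G] (O : LGConfig 4 G → ℝ) (Λ : Finset (Fin 4 → ℤ)) (a c m : ℝ), a ≠ 0 → ∀ (f : 𝓢(EuclideanSpace ℝ (Fin 4), ℝ)) (U : LGConfig 4 G), (∀ y : Fin 4 → ℤ, f (a • siteToE y) ≠ 0 → ((y ∈ Λ ↔ y - Pi.single 0 1 ∈ Λ) ∧ (y ∈ Λ ↔ y - Pi.single 1 1 ∈ Λ))) → smearedLatticeField O Λ a c m (SchwartzMap.smulLeftCLM ℝ (fun x : EuclideanSpace ℝ (Fin 4) => x 1) (a⁻¹ • (translateTest (-(a • (EuclideanSpace.single (0 : Fin 4) (1 : ℝ) : EuclideanSpace ℝ (Fin 4)))) f - f)) - SchwartzMap.smulLeftCLM ℝ (fun x : EuclideanSpace ℝ (Fin 4) => x 0) (a⁻¹ • (translateTest (-(a • (EuclideanSpace.single (1 : Fin 4) (1 : ℝ) : EuclideanSpace ℝ (Fin 4)))) f - f))) U = -(c * a ^ 4 * ∑ y ∈ Λ, f (a • siteToE y) * (((y 1 : ℤ) : ℝ) * (O (configShift (-y) U) - O (configShift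 (-(y - Pi.single 0 1)) U)) - ((y 0 : ℤ) : ℝ) * (O (configShift (-y) U) - O (configShift (-(y - Pi.single 1 1)) U)))) := by
  intro G _ O Λ a c m ha f U h
  simp only [smearedLatticeField]
  refine (congrArg (fun z : ℝ => c * a ^ 4 * z) ?_).trans (mul_neg _ _)
  have hg : ∀ y ∈ Λ,
      (SchwartzMap.smulLeftCLM ℝ (fun x : EuclideanSpace ℝ (Fin 4) => x 1)
            (a⁻¹ • (translateTest (-(a • (EuclideanSpace.single (0 : Fin 4) (1 : ℝ) : EuclideanSpace ℝ (Fin 4))))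
              f - f)) -
          SchwartzMap.smulLeftCLM ℝ (fun x : EuclideanSpace ℝ (Fin 4) => x 0)
            (a⁻¹ • (translateTest (-(a • (EuclideanSpace.single (1 : Fin 4) (1 : ℝ) : EuclideanSpace ℝ (Fin 4))))
              f - f))) (a • siteToE y) * (O (configShift (-y) U) - m) =
        (((y 1 : ℤ) : ℝ) * (f (a • siteToE (y + Pi.single 0 1)) - f (a • siteToE y)) -
            ((y 0 : ℤ) : ℝ) * (f (a • siteToE (y + Pi.single 1 1)) - f (a • siteToE y))) *
          (O (configShift (-y) U) - m) := fun y _ => by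
    rw [sub_apply, diffQuot_coord_apply f ha 0 1 y, diffQuot_coord_apply f ha 1 0 y]
  rw [Finset.sum_congr rfl hg]
  refine sum_sbp_combine Λ m (fun y => f (a • siteToE y)) (fun y => f (a • siteToE (y + Pi.single 0 1)))
    (fun y => f (a • siteToE (y + Pi.single 1 1))) (fun y => O (configShift (-y) U))
    (fun y => O (configShift (-(y - Pi.single 0 1)) U)) (fun y => O (configShift (-(y - Pi.single 1 1)) U))
    (fun y => ((y 0 : ℤ) : ℝ)) (fun y => ((y 1 : ℤ) : ℝ)) ?_ ?_
  · exact sum_shift_reindex O Λ a m f U (Pi.single 0 1) (fun y => ((y 1 : ℤ) : ℝ))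
      (fun y => by rw [Pi.add_apply, Pi.single_eq_of_ne (by decide), add_zero]) fun z hz => (h z hz).1
  · exact sum_shift_reindex O Λ a m f U (Pi.single 1 1) (fun y => ((y 0 : ℤ) : ℝ))
      (fun y => by rw [Pi.add_apply, Pi.single_eq_of_ne (by decide), add_zero]) fun z hz => (h z hz).2

end Summit.QuantumFields.YangMills.Cruxes.CurvatureAmnesia.WardDefect

end
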